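import Literature.Combinatorics.Optimization.DegreeReductionPsdRank
import Literature.Combinatorics.Optimization.DensityMatrixApproximation
import Literature.Combinatorics.Optimization.PsdFactorizationScaling
import Literature.LinearAlgebra.Matrix.HermitianCfcDiagonalForm
import Literature.Analysis.Convex.FrictionConeLMI
import HarnessLib

/-!
# Lee–Raghavendra–Steurer 2015, Theorem 3.1 from Theorems 3.3 and 3.4 (the assembly of §3.1), PROVED

The separation theorem LRS Thm 3.1 (the named fact `LeeRaghavendraSteurer2015_thm31` of
`SeparatingFunctionalPsdRank.lean`, from which Thm 3.8, Thm 1.1 and Cor 1.2 are already derived in the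
tree) is printed (arXiv:1411.6317, p. 14–16) as a two-page derivation from three theorems:
Thm 3.3 (psd factorization scaling; `LeeRaghavendraSteurer2015_thm33`, proved in
`PsdFactorizationScaling.lean` from [FawziEtAl2015, Cor. 6.8]), Thm 3.4 (density matrix approximation;
the named fact `LeeRaghavendraSteurer2015_thm34` of `DensityMatrixApproximation.lean`) and Thm 3.5
(degree reduction; proved in `DegreeReductionPsdRank.lean`).  This file PROVES that derivation,
`LeeRaghavendraSteurer2015_thm31_of_thm33_thm34 : _thm33 → _thm34 → _thm31`, hence
`LeeRaghavendraSteurer2015_thm31_of_cor68_thm34 : FawziEtAl2015_cor68 → _thm34 → _thm31`,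
following the printed proof step by step:

* `η = ε/(3‖D‖_∞)` and the factorization `N(S,x) ≤ Tr(P_S Q_x) ≤ N(S,x) + η` of Thm 3.3 for the psd
  rank `r₀` of `N` (the least size of a psd factorization, `r₀ ≤ r`); eq. (sos-2)
  `L_D(N) ≥ E D(x_S) Tr(P_S Q_x) − η‖D‖_∞` (`Thm31.sepFunctional_ge_of_sandwich`);
* the block matrices `Q = (1/τ) E_x(e_x e_xᵀ ⊗ Q_x)` (a density matrix, `τ = E_x Tr Q_x ∈ [‖N‖₁, ‖N‖₁ + η]`)
  and `F = Σ_x e_x e_xᵀ ⊗ F_x`, `F_x = E_S D(x_S) P_S`, with `E D(x_S)Tr(P_S Q_x) = τ Tr(FQ)` and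
  `−‖D‖_∞ Id ⪯ F ⪯ ‖D‖_∞ Id` (eq. (sos-1), from `E_S P_S = Id`) — realised as `Matrix.blockDiagonal`
  reindexed by `Fin (k·2ⁿ)`;
* eq. (entropy-deficit): `Q ⪯ ((η + r₀²) r₀/τ)·𝕀`, hence `S(Q‖𝕀) ≤ log((η + r₀²)r₀/τ)`
  (`Thm31.relEntropy_uniformDensity_le_log`: the eigenvalues of a density matrix `Q ⪯ c𝕀` are `≤ c/R`,
  so `Σ λ log λ ≤ log(c/R)`), and `≤ log 2 + 2d log n` under the hypothesis on `r₀`;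
* Thm 3.4 for `(F, Q, ‖D‖_∞, ε/6)`: a polynomial `p` of degree `k' ≤ 30 C₄ d ‖D‖_∞ log n/ε` with
  `Tr(F Q̃) ≤ Tr(FQ) + ε/6`, `Q̃ = p(F)²/Tr p(F)²`; `p(F) = Σ_x e_x e_xᵀ ⊗ p(F_x)`
  (`Thm31.aeval_blockDiagonal`) and `deg p(F_x) ≤ deg(p)·m` (`Thm31.hasDegreeLE_aeval_apply`,
  `Thm31.hasDegreeLE_comp_cubeRestrict`);
* Thm 3.5 for `A_S = P_S^{1/2}` (`CFC.sqrt`), `B_x = p(F_x)`, `max_S ‖A_S²‖ ≤ 2r₀²/η`: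
  `Tr(F Q̃) = E D(x_S)‖A_S B_x‖_F² / E_x‖B_x‖_F² ≥ −2‖D‖_∞ (k'm²/(n−m))^{d/4} (2r₀²/η)^{1/2}` (eq. (sos-3));
* the bookkeeping of p. 15–16 with `τ ≤ 2`, `n − m ≥ n/2`, `(n/log n)^{d/2} ≤ n^d` and the hypothesis
  `r₀² ≤ (Cε/(dm²‖D‖_∞))^{d/2} (ε/‖D‖_∞)³ (n/log n)^{d/2} ‖N‖₁`, `C = 1/(44789760 (C₄+1))`, giving
  each of the three error terms `≤ ε/3`.

Deviations from the printed text (bookkeeping only): the three error terms are balanced to give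
exactly `−ε` (the paper gets `−4ε` "up to scaling by a factor of 4"); the case `‖N‖₁ = 0` (then
`N = 0`) is treated separately; Thm 3.5 is used in the proved form
`LeeRaghavendraSteurer2015_thm35_of_nonneg` (no side conditions `ℓ, d ≤ n`).

Source: [LeeRaghavendraSteurer2015] held text `paper:arxiv-1411.6317`, §3.1 (p. 14–16: Thm 3.1 and
its proof, eqs. (tau-normalize), (entropy-deficit), (sos-1)–(sos-3), (functional-lb), (degree-bound)).
Theorems only (no definitions, no new facts).
-/

open Finset Matrix Polynomial
open scoped MatrixOrder

namespace Literature.Combinatorics.Optimization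

namespace Thm31

open Literature.LinearAlgebra.Matrix (cfc_continuousOn trace_cfc_eq_sum_eigenvalues)

/-! ### Entropy relative to the maximally mixed state under an operator upper bound -/

/-- The eigenvalues of a symmetric `Q ⪯ b·Id` are `≤ b` (conjugate `b·Id − Q ⪰ 0` into the
eigenbasis and read off the diagonal). [cite: LeeRaghavendraSteurer2015, §3.1 (p. 15, eq. (entropy-deficit): "Q ⪯ … 𝕀. Therefore S(Q‖𝕀) ≲ log …")] -/
theorem eigenvalues_le_of_le_smul_one {R : ℕ} {Q : Matrix (Fin R) (Fin R) ℝ} (hQ : Q.IsHermitian)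
    {b : ℝ} (hle : Q ≤ b • (1 : Matrix (Fin R) (Fin R) ℝ)) (i : Fin R) : hQ.eigenvalues i ≤ b := by
  obtain ⟨U, hU⟩ : ∃ U : Matrix (Fin R) (Fin R) ℝ,
      U = (hQ.eigenvectorUnitary : Matrix (Fin R) (Fin R) ℝ) := ⟨_, rfl⟩
  have hUm : U ∈ Matrix.unitaryGroup (Fin R) ℝ := hU ▸ hQ.eigenvectorUnitary.2
  have hUU : star U * U = 1 := Matrix.mem_unitaryGroup_iff'.1 hUm
  -- `Uᴴ Q U = diag(λ)`
  have hspec : Q = U * diagonal (RCLike.ofReal ∘ hQ.eigenvalues) * star U := by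
    rw [hU]
    conv_lhs => rw [hQ.spectral_theorem, Unitary.conjStarAlgAut_apply]
  have hdiag : star U * Q * U = diagonal (RCLike.ofReal ∘ hQ.eigenvalues) := by
    calc star U * Q * U = star U * (U * diagonal (RCLike.ofReal ∘ hQ.eigenvalues) * star U) * U := by
          conv_lhs => arg 1; arg 2; rw [hspec]
      _ = diagonal (RCLike.ofReal ∘ hQ.eigenvalues) := by
          simp only [Matrix.mul_assoc]
          rw [← Matrix.mul_assoc (star U) U, hUU, Matrix.one_mul, Matrix.mul_one]
  -- conjugate the psd matrix `b·Id − Q`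
  rw [Matrix.le_iff] at hle
  have hpsd := hle.conjTranspose_mul_mul_same U
  rw [← star_eq_conjTranspose, Matrix.mul_sub, Matrix.sub_mul, Matrix.mul_smul, Matrix.mul_one,
    Matrix.smul_mul, hUU, hdiag] at hpsd
  have h := hpsd.diag_nonneg (i := i)
  simp only [Matrix.sub_apply, Matrix.smul_apply, Matrix.one_apply_eq, diagonal_apply_eq,
    smul_eq_mul, mul_one, Function.comp_apply, RCLike.ofReal_real_eq_id, id_eq] at h
  linarith

/-- `Tr(Q log Q) = Σ_k λ_k log λ_k` for symmetric `Q`. [cite: LeeRaghavendraSteurer2015, §2.1 (p. 10: "S(X) = −Tr(X log X)")] -/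
theorem trace_mul_cfc_log_eq_sum {R : ℕ} {Q : Matrix (Fin R) (Fin R) ℝ} (hQ : Q.IsHermitian) :
    (Q * cfc Real.log Q).trace = ∑ k, hQ.eigenvalues k * Real.log (hQ.eigenvalues k) := by
  have hQ' : IsSelfAdjoint Q := hQ
  have hmul : Q * cfc Real.log Q = cfc (fun x => x * Real.log x) Q := by
    rw [cfc_mul (fun x : ℝ => x) Real.log Q (cfc_continuousOn Q _) (cfc_continuousOn Q _),
      cfc_id' ℝ Q]
  rw [hmul, trace_cfc_eq_sum_eigenvalues hQ]
  rfl

/-- **`S(Q‖𝕀) ≤ log c` whenever the density matrix `Q` satisfies `Q ⪯ c·𝕀`** (the step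
"`Q ⪯ ((η + rk²)rk/τ)·𝕀`.  Therefore `S(Q‖𝕀) ≲ log(η rk/τ)`" of the printed proof: the
eigenvalues `λ_k ≤ c/R` of `Q` give `Σ λ_k log λ_k ≤ log(c/R)`, and `S(Q‖𝕀) = log R + Σ λ_k log λ_k`).
[cite: LeeRaghavendraSteurer2015, §3.1 (p. 15, eq. (entropy-deficit))] -/
theorem relEntropy_uniformDensity_le_log {R : ℕ} {Q : Matrix (Fin R) (Fin R) ℝ}
    (hQ : IsDensityMatrix Q) {c : ℝ} (hc : 0 < c) (hle : Q ≤ c • uniformDensity R) :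
    relEntropy Q (uniformDensity R) ≤ Real.log c := by
  have hR : 0 < R := by
    rcases Nat.eq_zero_or_pos R with h | h
    · exfalso
      subst h
      have := hQ.2
      rw [Matrix.trace_fin_zero] at this
      exact zero_ne_one this
    · exact h
  have hR' : (0 : ℝ) < R := by exact_mod_cast hR
  have hherm : Q.IsHermitian := hQ.1.1
  rw [relEntropy_uniformDensity hR hQ.2, vonNeumannEntropy, trace_mul_cfc_log_eq_sum hherm,
    sub_neg_eq_add]
  -- eigenvalue facts: `0 ≤ λ_k ≤ c/R`, `Σ λ_k = 1`
  have hle' : Q ≤ (c / R) • (1 : Matrix (Fin R) (Fin R) ℝ) := by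
    rw [uniformDensity, smul_smul] at hle
    rw [div_eq_mul_one_div]
    exact hle
  have hlam_le : ∀ k, hherm.eigenvalues k ≤ c / R := eigenvalues_le_of_le_smul_one hherm hle'
  have hlam_nn : ∀ k, 0 ≤ hherm.eigenvalues k := fun k => hQ.1.eigenvalues_nonneg k
  have hsum : ∑ k, hherm.eigenvalues k = 1 := by
    have h := hherm.trace_eq_sum_eigenvalues
    rw [hQ.2] at h
    exact_mod_cast h.symm
  -- `λ log λ ≤ λ log(c/R)` termwise
  have hterm : ∀ k, hherm.eigenvalues k * Real.log (hherm.eigenvalues k) ≤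
      hherm.eigenvalues k * Real.log (c / R) := by
    intro k
    rcases (hlam_nn k).eq_or_lt with h0 | hpos
    · rw [← h0]; simp
    · exact mul_le_mul_of_nonneg_left (Real.log_le_log hpos (hlam_le k)) (hlam_nn k)
  calc Real.log R + ∑ k, hherm.eigenvalues k * Real.log (hherm.eigenvalues k)
      ≤ Real.log R + ∑ k, hherm.eigenvalues k * Real.log (c / R) := by
        have := sum_le_sum fun k (_ : k ∈ univ) => hterm k
        linarith
    _ = Real.log c := by
        rw [← sum_mul, hsum, one_mul, Real.log_div hc.ne' hR'.ne']
        ring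


/-! ### Block-diagonal matrices, reindexing, polynomials, traces -/

section Blocks

variable {o : Type*} [Fintype o] [DecidableEq o] {k : ℕ}

/-- `p(diag(M_x)_x) = diag(p(M_x))_x` ("`p(F) = Σ_x e_x e_xᵀ ⊗ p(F_x)`"). [cite: LeeRaghavendraSteurer2015, §3.1 (p. 15: "the map x ↦ Q̃_x = p(F_x)²/E_x Tr(p(F_x)²)")] -/
theorem aeval_blockDiagonal (M : o → Matrix (Fin k) (Fin k) ℝ) (p : ℝ[X]) :
    aeval (blockDiagonal M) p = blockDiagonal fun x => aeval (M x) p := by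
  induction p using Polynomial.induction_on' with
  | add p q hp hq =>
    simp only [map_add, hp, hq]
    rw [← blockDiagonal_add]
    rfl
  | monomial j c =>
    simp only [aeval_monomial, Algebra.algebraMap_eq_smul_one, smul_mul_assoc, one_mul]
    rw [← blockDiagonal_pow, ← blockDiagonal_smul]
    rfl

/-- Loewner order blockwise. [cite: LeeRaghavendraSteurer2015, §3.1 (p. 15: "the density matrix Q satisfies Q ⪯ … 𝕀")] -/
theorem blockDiagonal_le_blockDiagonal {M N : o → Matrix (Fin k) (Fin k) ℝ} (h : ∀ x, M x ≤ N x) :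
    blockDiagonal M ≤ blockDiagonal N := by
  rw [Matrix.le_iff, ← blockDiagonal_sub]
  refine (Literature.Analysis.Convex.FrictionConeLMI.posSemidef_blockDiagonal_iff _).2 fun x => ?_
  have := h x
  rw [Matrix.le_iff] at this
  exact this

omit [Fintype o] in
/-- `diag(c·Id)_x = c·Id`. [cite: LeeRaghavendraSteurer2015, §3.1 (p. 15)] -/
theorem blockDiagonal_const_smul_one (c : ℝ) :
    blockDiagonal (fun _ : o => c • (1 : Matrix (Fin k) (Fin k) ℝ)) = c • 1 := by
  show blockDiagonal (c • (1 : o → Matrix (Fin k) (Fin k) ℝ)) = c • 1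
  rw [blockDiagonal_smul, blockDiagonal_one]

end Blocks

/-- The trace is invariant under reindexing. [cite: LeeRaghavendraSteurer2015, §2.1 (p. 10: operators as matrices in a basis)] -/
theorem trace_submatrix_equiv {ι κ : Type*} [Fintype ι] [Fintype κ] (M : Matrix κ κ ℝ) (e : ι ≃ κ) :
    (M.submatrix e e).trace = M.trace := by
  simp only [Matrix.trace, Matrix.diag, Matrix.submatrix_apply]
  exact e.sum_comp (fun j => M j j)

/-- Loewner order under reindexing. [cite: LeeRaghavendraSteurer2015, §2.1 (p. 10)] -/
theorem submatrix_le_submatrix {ι κ : Type*} [Fintype ι] [Fintype κ] [DecidableEq ι] [DecidableEq κ]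
    {A B : Matrix κ κ ℝ} (h : A ≤ B) (e : ι → κ) : A.submatrix e e ≤ B.submatrix e e := by
  rw [Matrix.le_iff] at h ⊢
  exact h.submatrix e

/-! ### `E_{S,x}` plumbing -/

section Expect

variable {n m : ℕ}

/-- Monotonicity of `E_{S,x}`. [cite: LeeRaghavendraSteurer2015, §3.1 (p. 14: E_{S,x})] -/
theorem subsetCubeExpect_mono {f g : {S : Finset (Fin n) // S.card = m} → (Fin n → Bool) → ℝ}
    (h : ∀ S x, f S x ≤ g S x) : subsetCubeExpect n m f ≤ subsetCubeExpect n m g := by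
  unfold subsetCubeExpect
  exact div_le_div_of_nonneg_right (sum_le_sum fun S _ => sum_le_sum fun x _ => h S x)
    (by positivity)

/-- `E_{S,x}` is additive. [cite: LeeRaghavendraSteurer2015, §3.1 (p. 14)] -/
theorem subsetCubeExpect_add (f g : {S : Finset (Fin n) // S.card = m} → (Fin n → Bool) → ℝ) :
    subsetCubeExpect n m (fun S x => f S x + g S x) =
      subsetCubeExpect n m f + subsetCubeExpect n m g := by
  unfold subsetCubeExpect
  rw [← add_div]
  congr 1
  rw [← sum_add_distrib]
  exact sum_congr rfl fun S _ => sum_add_distrib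

/-- `E_{S,x}` is homogeneous. [cite: LeeRaghavendraSteurer2015, §3.1 (p. 14)] -/
theorem subsetCubeExpect_const_mul (c : ℝ) (f : {S : Finset (Fin n) // S.card = m} → (Fin n → Bool) → ℝ) :
    subsetCubeExpect n m (fun S x => c * f S x) = c * subsetCubeExpect n m f := by
  unfold subsetCubeExpect
  rw [mul_div_assoc']
  congr 1
  rw [mul_sum]
  exact sum_congr rfl fun S _ => (mul_sum _ _ _).symm

/-- `E_{S,x} c = c` (for `m ≤ n`). [cite: LeeRaghavendraSteurer2015, §3.1 (p. 14)] -/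
theorem subsetCubeExpect_const (hmn : m ≤ n) (c : ℝ) :
    subsetCubeExpect n m (fun _ _ => c) = c := by
  unfold subsetCubeExpect
  have hc : (0 : ℝ) < (Fintype.card {S : Finset (Fin n) // S.card = m} : ℝ) := by
    rw [Fintype.card_finset_len, Fintype.card_fin]
    exact_mod_cast Nat.choose_pos hmn
  have hc' := hc.ne'
  simp only [sum_const, card_univ, Fintype.card_fun, Fintype.card_bool, Fintype.card_fin, nsmul_eq_mul]
  push_cast
  field_simp

/-- `E_{S,x}` of a nonnegative function is nonnegative. [cite: LeeRaghavendraSteurer2015, §3.1 (p. 14)] -/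
theorem subsetCubeExpect_nonneg {f : {S : Finset (Fin n) // S.card = m} → (Fin n → Bool) → ℝ}
    (h : ∀ S x, 0 ≤ f S x) : 0 ≤ subsetCubeExpect n m f := by
  unfold subsetCubeExpect
  exact div_nonneg (sum_nonneg fun S _ => sum_nonneg fun x _ => h S x) (by positivity)

/-- **The first `≥` of eq. (sos-2):** if `N ≤ T ≤ N + η` entrywise and `|D| ≤ K`, then
`L_D(N) ≥ L_D(T) − Kη`. [cite: LeeRaghavendraSteurer2015, §3.1 (p. 15, eq. (sos-2): "≥ E_x E_S D(x_S)·Tr(P_S Q_x) − η‖D‖_∞")] -/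
theorem sepFunctional_ge_of_sandwich {D : (Fin m → Bool) → ℝ} {K η : ℝ} (hDK : ∀ y, |D y| ≤ K)
    {N T : {S : Finset (Fin n) // S.card = m} → (Fin n → Bool) → ℝ}
    (h : ∀ S x, N S x ≤ T S x ∧ T S x ≤ N S x + η) (hmn : m ≤ n) :
    sepFunctional D T - K * η ≤ sepFunctional D N := by
  have hpt : ∀ S x, D (cubeRestrict S x) * T S x - K * η ≤ D (cubeRestrict S x) * N S x := by
    intro S x
    have h1 : |D (cubeRestrict S x) * (T S x - N S x)| ≤ K * η := by
      rw [abs_mul]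
      exact mul_le_mul (hDK _) (abs_le.2 ⟨by linarith [(h S x).1, (h S x).2], by linarith [(h S x).2]⟩)
        (abs_nonneg _) ((abs_nonneg (D (cubeRestrict S x))).trans (hDK (cubeRestrict S x)))
    have h2 := (abs_le.1 h1).2
    nlinarith [h2]
  unfold sepFunctional
  have := subsetCubeExpect_mono hpt
  rw [show (fun S x => D (cubeRestrict S x) * T S x - K * η) =
      fun S x => D (cubeRestrict S x) * T S x + (-(K * η)) from by funext S x; ring,
    subsetCubeExpect_add, subsetCubeExpect_const hmn] at this
  linarith

end Expect

/-! ### Degrees -/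

section Degrees

open Literature.Probability.RandomGraphs.LowDegree (walsh)
open Literature.Computability.Complexity.LowDegree (cubeFourierCoeff sum_cubeFourierCoeff_mul_walsh)

variable {n m : ℕ}

/-- `x ↦ D(x_S)` has degree `≤ m` ("`deg(F) ≤ deg(D) ≤ m` (since `D : {0,1}^m → ℝ`)").
[cite: LeeRaghavendraSteurer2015, §3.1 (p. 15)] -/
theorem hasDegreeLE_comp_cubeRestrict (S : {S : Finset (Fin n) // S.card = m})
    (D : (Fin m → Bool) → ℝ) : HasDegreeLE m (fun x => D (cubeRestrict S x)) := by
  have hrepr : (fun x => D (cubeRestrict S x)) = fun x => ∑ T : Finset (Fin m),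
      cubeFourierCoeff D T * walsh (T.map (S.1.orderEmbOfFin S.2).toEmbedding) x := by
    funext x
    rw [← sum_cubeFourierCoeff_mul_walsh D (cubeRestrict S x)]
    refine sum_congr rfl fun T _ => ?_
    congr 1
    unfold Literature.Probability.RandomGraphs.LowDegree.walsh
    rw [Finset.prod_map]
    rfl
  rw [hrepr]
  refine HasDegreeLE.sum univ fun T _ => (hasDegreeLE_walsh_of_card_le ?_).const_mul _
  rw [card_map]
  exact (card_le_univ T).trans (by rw [Fintype.card_fin])

variable {k : ℕ}

/-- Entries of powers: `deg (F^t)_{ij} ≤ t · deg F`. [cite: LeeRaghavendraSteurer2015, §3.1 (p. 15: "the degree of the map x ↦ p(F_x)² is at most deg(p)·m")] -/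
theorem hasDegreeLE_pow_apply {a : ℕ} (F : (Fin n → Bool) → Matrix (Fin k) (Fin k) ℝ)
    (hF : ∀ i j, HasDegreeLE a fun x => F x i j) (t : ℕ) (i j : Fin k) :
    HasDegreeLE (t * a) fun x => (F x ^ t) i j := by
  induction t generalizing i j with
  | zero =>
    simp only [pow_zero, zero_mul]
    exact HasDegreeLE.const _ _
  | succ t ih =>
    have h : (fun x => (F x ^ (t + 1)) i j) = fun x => ∑ q, (F x ^ t) i q * F x q j := by
      funext x
      rw [pow_succ, Matrix.mul_apply]
    rw [h, Nat.succ_mul]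
    exact HasDegreeLE.sum univ fun q _ => (ih i q).mul (hF q j)

/-- Entries of `p(F_x)`: degree `≤ deg(p) · deg F`. [cite: LeeRaghavendraSteurer2015, §3.1 (p. 15: "at most deg(p)·m = k·m")] -/
theorem hasDegreeLE_aeval_apply {a : ℕ} (F : (Fin n → Bool) → Matrix (Fin k) (Fin k) ℝ)
    (hF : ∀ i j, HasDegreeLE a fun x => F x i j) (p : ℝ[X]) (i j : Fin k) :
    HasDegreeLE (p.natDegree * a) fun x => aeval (F x) p i j := by
  have h : (fun x => aeval (F x) p i j) =
      fun x => ∑ t ∈ range (p.natDegree + 1), p.coeff t * (F x ^ t) i j := by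
    funext x
    rw [aeval_eq_sum_range, Matrix.sum_apply]
    refine sum_congr rfl fun t _ => ?_
    rw [Matrix.smul_apply, smul_eq_mul]
  rw [h]
  refine HasDegreeLE.sum _ fun t ht => ((hasDegreeLE_pow_apply F hF t i j).const_mul _).mono ?_
  exact Nat.mul_le_mul_right _ (Nat.lt_succ_iff.1 (mem_range.1 ht))

end Degrees

end Thm31

/-! ### The assembly (p. 15–16) -/

set_option maxHeartbeats 800000 in
open Thm31 in
/-- **Lee–Raghavendra–Steurer 2015, Theorem 3.1 from Theorems 3.3 and 3.4 (PROVED assembly).**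
The printed derivation of Thm 3.1 (p. 15–16): psd factorization scaling (Thm 3.3) with
`η = ε/(3‖D‖_∞)`, the block density matrix `Q = (1/τ) E_x (e_x e_xᵀ ⊗ Q_x)` and the block
symmetric matrix `F = Σ_x e_x e_xᵀ ⊗ E_S D(x_S) P_S` with `‖F‖ ≤ ‖D‖_∞`, the entropy deficit
`S(Q‖𝕀) ≤ log((η + rk²)rk/τ)`, density matrix approximation (Thm 3.4) by `Q̃ = p(F)²/Tr p(F)²`,
degree reduction (Thm 3.5, proved: `LeeRaghavendraSteurer2015_thm35_of_nonneg`) for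
`N'(S,x) = Tr(P_S p(F_x)²) = ‖P_S^{1/2} p(F_x)‖_F²` with `deg p(F_x) ≤ deg(p)·m`, and the final
bookkeeping with the hypothesis `rk_psd(N)² ≤ α (n/log n)^{d/2} ‖N‖₁`.  The universal constant is
`C = 1/(44789760 (C₄ + 1))`, `C₄` the constant of Thm 3.4. [cite: LeeRaghavendraSteurer2015, Thm. 3.1 and its proof (p. 14–16)] -/
theorem LeeRaghavendraSteurer2015_thm31_of_thm33_thm34
    (h33 : LeeRaghavendraSteurer2015_thm33) (h34 : LeeRaghavendraSteurer2015_thm34) :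
    LeeRaghavendraSteurer2015_thm31 := by
  classical
  obtain ⟨C₄, hC₄, H34⟩ := h34
  refine ⟨1 / (44789760 * (C₄ + 1)), by positivity, ?_⟩
  intro m d hm hd ε hε hε1 D K hD hDK n hn N hN r hr hbound
  obtain ⟨C, hC⟩ : ∃ C : ℝ, C = 1 / (44789760 * (C₄ + 1)) := ⟨_, rfl⟩
  rw [← hC] at hbound
  have hC0 : 0 < C := by rw [hC]; positivity
  have hC1 : C ≤ 1 := by
    rw [hC, div_le_one (by positivity)]; linarith only [hC₄]
  have h60C : 60 * C₄ * C ≤ 1 / 746496 := by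
    rw [hC, show 60 * C₄ * (1 / (44789760 * (C₄ + 1))) = 60 * C₄ / (44789760 * (C₄ + 1)) by ring,
      div_le_div_iff₀ (by positivity) (by norm_num)]
    linarith only [hC₄]
  have hmn : m < n := by omega
  -- elementary real facts
  have hm1 : (1 : ℝ) ≤ m := by exact_mod_cast hm
  have hd1 : (1 : ℝ) ≤ d := by exact_mod_cast hd
  have hK1 : 1 ≤ K := by
    have h := cubeExpect_le_of_forall_le (g := D) (s := K) fun x => (le_abs_self _).trans (hDK x)
    rw [hD.1] at h
    exact h
  have hK0 : 0 < K := by linarith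
  have hn2 : (2 : ℝ) ≤ n := by exact_mod_cast (show 2 ≤ n by omega)
  have hn0 : (0 : ℝ) < n := by linarith
  have hlog2 : (1 / 2 : ℝ) < Real.log 2 := by
    have := Real.log_two_gt_d9; linarith
  have hlogn : Real.log 2 ≤ Real.log n := Real.log_le_log two_pos hn2
  have hlogn0 : 0 < Real.log n := by linarith
  have hnm2 : (n : ℝ) / 2 ≤ (n : ℝ) - m := by
    have : ((2 * m : ℕ) : ℝ) ≤ n := by exact_mod_cast hn
    push_cast at this
    linarith
  obtain ⟨cS, hcS_def⟩ : ∃ c : ℝ, c = (Fintype.card {S : Finset (Fin n) // S.card = m} : ℝ) :=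
    ⟨_, rfl⟩
  have hcS : 0 < cS := by
    rw [hcS_def, Fintype.card_finset_len, Fintype.card_fin]
    exact_mod_cast Nat.choose_pos hmn.le
  haveI hne : Nonempty {S : Finset (Fin n) // S.card = m} := by
    rw [← Fintype.card_pos_iff]
    exact_mod_cast (hcS_def ▸ hcS : (0 : ℝ) < (Fintype.card {S : Finset (Fin n) // S.card = m} : ℝ))
  -- `‖N‖₁`
  have havg0 : 0 ≤ entryAverage N := subsetCubeExpect_nonneg fun S x => (hN S x).1
  have havg1 : entryAverage N ≤ 1 := by
    have := subsetCubeExpect_mono (f := N) (g := fun _ _ => (1 : ℝ)) fun S x => (hN S x).2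
    rwa [subsetCubeExpect_const hmn.le] at this
  rcases havg0.eq_or_lt with havg | havg
  · -- `‖N‖₁ = 0`: then `N = 0` and `L_D(N) = 0`
    have hz : ∀ S x, N S x = 0 := by
      have hsum : ∑ S, ∑ x, N S x = 0 := by
        have h := havg.symm
        unfold entryAverage subsetCubeExpect at h
        rw [← hcS_def] at h
        rcases div_eq_zero_iff.1 h with h | h
        · exact h
        · exfalso; exact absurd h (by positivity)
      intro S x
      have h1 := (sum_eq_zero_iff_of_nonneg fun S _ => sum_nonneg fun x _ => (hN S x).1).1 hsum S
        (mem_univ _)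
      exact (sum_eq_zero_iff_of_nonneg fun x _ => (hN S x).1).1 h1 x (mem_univ _)
    have : sepFunctional D N = 0 := by
      unfold sepFunctional subsetCubeExpect
      simp [hz]
    rw [this]
    linarith
  -- the psd rank `r₀ ≤ r` of `N`
  obtain ⟨r₀, hr₀, hmin, hr₀r⟩ : ∃ r₀, HasPsdFactorization N r₀ ∧
      (∀ r', HasPsdFactorization N r' → r₀ ≤ r') ∧ r₀ ≤ r :=
    ⟨Nat.find ⟨r, hr⟩, Nat.find_spec ⟨r, hr⟩, fun r' h => Nat.find_min' _ h, Nat.find_min' _ hr⟩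
  have hr₀1 : 1 ≤ r₀ := by
    by_contra h0
    have h0' : r₀ = 0 := by omega
    subst h0'
    obtain ⟨A0, B0, -, -, hAB⟩ := hr₀
    have hz : ∀ S x, N S x = 0 := fun S x => by
      rw [hAB S x]
      exact Matrix.trace_fin_zero _
    have : entryAverage N = 0 := by
      unfold entryAverage subsetCubeExpect
      simp [hz]
    linarith
  have hr₀1' : (1 : ℝ) ≤ r₀ := by exact_mod_cast hr₀1
  have hr₀sq : (r₀ : ℝ) ^ 2 ≤ (r : ℝ) ^ 2 := by
    have : (r₀ : ℝ) ≤ r := by exact_mod_cast hr₀r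
    exact pow_le_pow_left₀ (by positivity) this 2
  -- the bound `bnd = α (n/log n)^{d/2}` with `r₀² ≤ bnd · ‖N‖₁`, `bnd ≤ n^d`
  obtain ⟨bnd, hbnd⟩ : ∃ b : ℝ, b = (C * ε / (d * (m : ℝ) ^ 2 * K)) ^ ((d : ℝ) / 2) * (ε / K) ^ 3 *
      ((n : ℝ) / Real.log n) ^ ((d : ℝ) / 2) := ⟨_, rfl⟩
  have hr₀bnd : (r₀ : ℝ) ^ 2 ≤ bnd * entryAverage N := by rw [hbnd]; exact hr₀sq.trans hbound
  have ha₁0 : 0 ≤ C * ε / (d * (m : ℝ) ^ 2 * K) := by positivity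
  have ha₁1 : C * ε / (d * (m : ℝ) ^ 2 * K) ≤ 1 := by
    rw [div_le_one (by positivity)]
    have h1 : C * ε ≤ 1 := by
      have := mul_le_mul hC1 hε1 hε.le zero_le_one
      linarith only [this]
    have hm2 : (1 : ℝ) ≤ (m : ℝ) ^ 2 := one_le_pow₀ hm1
    have h2 : (1 : ℝ) * 1 * 1 ≤ d * (m : ℝ) ^ 2 * K :=
      mul_le_mul (mul_le_mul hd1 hm2 zero_le_one (by positivity)) hK1 zero_le_one (by positivity)
    linarith only [h1, h2]
  have hbnd0 : 0 ≤ bnd := by rw [hbnd]; positivity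
  have hnlog : (n : ℝ) / Real.log n ≤ (n : ℝ) ^ 2 := by
    rw [div_le_iff₀ hlogn0]
    nlinarith
  have hbndn : bnd ≤ (n : ℝ) ^ d := by
    have h1 : (C * ε / (d * (m : ℝ) ^ 2 * K)) ^ ((d : ℝ) / 2) ≤ 1 :=
      Real.rpow_le_one ha₁0 ha₁1 (by positivity)
    have h2 : (ε / K) ^ 3 ≤ 1 := pow_le_one₀ (by positivity) ((div_le_one hK0).2 (by linarith))
    have h3 : ((n : ℝ) / Real.log n) ^ ((d : ℝ) / 2) ≤ (n : ℝ) ^ d := by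
      calc ((n : ℝ) / Real.log n) ^ ((d : ℝ) / 2) ≤ ((n : ℝ) ^ 2) ^ ((d : ℝ) / 2) :=
            Real.rpow_le_rpow (by positivity) hnlog (by positivity)
        _ = (n : ℝ) ^ d := by
            rw [← Real.rpow_natCast (n : ℝ) 2, ← Real.rpow_mul hn0.le,
              show ((2 : ℕ) : ℝ) * ((d : ℝ) / 2) = (d : ℕ) by push_cast; ring, Real.rpow_natCast]
    rw [hbnd]
    calc _ ≤ 1 * 1 * (n : ℝ) ^ d := by gcongr
      _ = (n : ℝ) ^ d := by ring
  have hbndpos : 0 < bnd := by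
    have : 0 < bnd * entryAverage N := lt_of_lt_of_le (by positivity) hr₀bnd
    exact (mul_pos_iff_of_pos_right havg).1 this
  -- `η`
  obtain ⟨η, hη⟩ : ∃ η : ℝ, η = ε / (3 * K) := ⟨_, rfl⟩
  have hη0 : 0 < η := by rw [hη]; positivity
  have hη1 : η ≤ 1 := by
    rw [hη, div_le_one (by positivity)]; linarith only [hε1, hK1]
  have hKη : K * η = ε / 3 := by rw [hη]; field_simp
  -- Theorem 3.3
  obtain ⟨k, P, Q, hP, hQ, hPQ, hsumP, hPle, hQle⟩ :=
    h33 {S : Finset (Fin n) // S.card = m} (Fin n → Bool) N 1 (fun S x => hN S x) η hη0 hη1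
      r₀ hr₀ hmin
  rw [← hcS_def] at hsumP
  -- `τ = E_{S,x} Tr(P_S Q_x) = E_x Tr Q_x ∈ [‖N‖₁, ‖N‖₁ + η]`
  obtain ⟨T, hT⟩ : ∃ T : {S : Finset (Fin n) // S.card = m} → (Fin n → Bool) → ℝ,
      T = fun S x => (P S * Q x).trace := ⟨_, rfl⟩
  have hT' : ∀ S x, T S x = (P S * Q x).trace := fun S x => by rw [hT]
  obtain ⟨t, ht_def⟩ : ∃ t : ℝ, t = subsetCubeExpect n m T := ⟨_, rfl⟩
  have hPQ' : ∀ S x, N S x ≤ T S x ∧ T S x ≤ N S x + η := fun S x => by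
    have := hPQ S x
    rw [mul_one, ← hT' S x] at this
    exact this
  have ht_ge : entryAverage N ≤ t := ht_def ▸ subsetCubeExpect_mono fun S x => (hPQ' S x).1
  have ht_le : t ≤ entryAverage N + η := by
    have := subsetCubeExpect_mono fun S x => (hPQ' S x).2
    rw [subsetCubeExpect_add N (fun _ _ => η), subsetCubeExpect_const hmn.le] at this
    rw [ht_def]
    exact this
  have ht0 : 0 < t := lt_of_lt_of_le havg ht_ge
  have ht2 : t ≤ 2 := by linarith
  have hsumPQ : ∀ x, ∑ S, (P S * Q x).trace = cS * (Q x).trace := by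
    intro x
    rw [← trace_sum, ← Finset.sum_mul, hsumP, Matrix.smul_mul, Matrix.one_mul, trace_smul,
      smul_eq_mul]
  have ht_eq : ∑ x, (Q x).trace = t * 2 ^ n := by
    have h : t = (∑ x, (Q x).trace) / 2 ^ n := by
      rw [ht_def]
      unfold subsetCubeExpect
      rw [← hcS_def, Finset.sum_comm]
      simp only [hT', hsumPQ]
      rw [← mul_sum, mul_div_mul_left _ _ hcS.ne']
    rw [h]
    field_simp
  -- the blocks `F_x = E_S D(x_S) P_S` and `Q_x/(τ 2ⁿ)`
  obtain ⟨Fx, hFx⟩ : ∃ Fx : (Fin n → Bool) → Matrix (Fin k) (Fin k) ℝ,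
      Fx = fun x => (1 / cS) • ∑ S, D (cubeRestrict S x) • P S := ⟨_, rfl⟩
  have hFx' : ∀ x, Fx x = (1 / cS) • ∑ S, D (cubeRestrict S x) • P S := fun x => by rw [hFx]
  obtain ⟨Qx, hQx⟩ : ∃ Qx : (Fin n → Bool) → Matrix (Fin k) (Fin k) ℝ,
      Qx = fun x => (1 / (t * 2 ^ n)) • Q x := ⟨_, rfl⟩
  have hQx' : ∀ x, Qx x = (1 / (t * 2 ^ n)) • Q x := fun x => by rw [hQx]
  have hPsymm : ∀ S, (P S).IsSymm := fun S => by
    have h := (hP S).1.eq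
    rwa [conjTranspose_eq_transpose_of_trivial] at h
  have hFxsymm : ∀ x, (Fx x).IsSymm := by
    intro x
    rw [hFx' x]
    show ((1 / cS) • ∑ S, D (cubeRestrict S x) • P S)ᵀ = _
    rw [transpose_smul, Matrix.transpose_sum]
    congr 1
    exact sum_congr rfl fun S _ => by rw [transpose_smul, (hPsymm S).eq]
  -- `−‖D‖_∞ Id ⪯ F_x ⪯ ‖D‖_∞ Id`
  have hFx_le : ∀ x, Fx x ≤ K • (1 : Matrix (Fin k) (Fin k) ℝ) := by
    intro x
    have h1 : ∑ S, (K - D (cubeRestrict S x)) • P S =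
        (K * cS) • (1 : Matrix (Fin k) (Fin k) ℝ) - ∑ S, D (cubeRestrict S x) • P S := by
      simp only [sub_smul, sum_sub_distrib, ← Finset.smul_sum, hsumP, smul_smul]
    have heq : K • (1 : Matrix (Fin k) (Fin k) ℝ) - Fx x =
        (1 / cS) • ∑ S, (K - D (cubeRestrict S x)) • P S := by
      rw [h1, hFx' x, smul_sub, smul_smul, show 1 / cS * (K * cS) = K by field_simp]
    rw [Matrix.le_iff, heq]
    exact (posSemidef_sum _ fun S _ => (hP S).smul
      (by linarith [le_abs_self (D (cubeRestrict S x)), hDK (cubeRestrict S x)])).smul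
      (by positivity)
  have hFx_ge : ∀ x, (-K) • (1 : Matrix (Fin k) (Fin k) ℝ) ≤ Fx x := by
    intro x
    have h1 : ∑ S, (D (cubeRestrict S x) + K) • P S =
        ∑ S, D (cubeRestrict S x) • P S + (K * cS) • (1 : Matrix (Fin k) (Fin k) ℝ) := by
      simp only [add_smul, sum_add_distrib, ← Finset.smul_sum, hsumP, smul_smul]
    have heq : Fx x - (-K) • (1 : Matrix (Fin k) (Fin k) ℝ) =
        (1 / cS) • ∑ S, (D (cubeRestrict S x) + K) • P S := by
      rw [h1, hFx' x, smul_add, smul_smul, show 1 / cS * (K * cS) = K by field_simp, neg_smul,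
        sub_neg_eq_add]
    rw [Matrix.le_iff, heq]
    exact (posSemidef_sum _ fun S _ => (hP S).smul
      (by linarith [neg_abs_le (D (cubeRestrict S x)), hDK (cubeRestrict S x)])).smul
      (by positivity)
  -- the big matrices `F, Q` on `ℝ^{k·2ⁿ}`, reindexed by `Fin R`
  obtain ⟨e, -⟩ : ∃ _ : Fin (Fintype.card (Fin k × (Fin n → Bool))) ≃ (Fin k × (Fin n → Bool)),
      True := ⟨(Fintype.equivFin _).symm, trivial⟩
  have hRk : ((Fintype.card (Fin k × (Fin n → Bool)) : ℕ) : ℝ) = k * 2 ^ n := by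
    rw [Fintype.card_prod, Fintype.card_fin, Fintype.card_fun, Fintype.card_bool, Fintype.card_fin]
    push_cast
    ring
  obtain ⟨F', hF'⟩ : ∃ F' : Matrix (Fin (Fintype.card (Fin k × (Fin n → Bool))))
      (Fin (Fintype.card (Fin k × (Fin n → Bool)))) ℝ, F' = (blockDiagonal Fx).submatrix e e :=
    ⟨_, rfl⟩
  obtain ⟨Q', hQ'⟩ : ∃ Q' : Matrix (Fin (Fintype.card (Fin k × (Fin n → Bool))))
      (Fin (Fintype.card (Fin k × (Fin n → Bool)))) ℝ, Q' = (blockDiagonal Qx).submatrix e e :=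
    ⟨_, rfl⟩
  have hF'symm : F'.IsSymm := by
    rw [hF']
    refine Matrix.IsSymm.submatrix ?_ e
    show (blockDiagonal Fx)ᵀ = blockDiagonal Fx
    rw [blockDiagonal_transpose]
    congr 1
    funext x
    exact (hFxsymm x).eq
  have hQ'psd : Q'.PosSemidef := by
    rw [hQ']
    refine Matrix.PosSemidef.submatrix ?_ e
    refine (Literature.Analysis.Convex.FrictionConeLMI.posSemidef_blockDiagonal_iff Qx).2 fun x => ?_
    rw [hQx' x]
    exact (hQ x).smul (by positivity)
  have hQ'tr : Q'.trace = 1 := by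
    rw [hQ', trace_submatrix_equiv, trace_blockDiagonal]
    simp only [hQx', trace_smul, smul_eq_mul]
    rw [← mul_sum, ht_eq]
    field_simp
  have hQ'dens : IsDensityMatrix Q' := ⟨hQ'psd, hQ'tr⟩
  have hF'le : F' ≤ K • (1 : Matrix _ _ ℝ) := by
    have h := submatrix_le_submatrix (blockDiagonal_le_blockDiagonal hFx_le) e
    rw [blockDiagonal_const_smul_one] at h
    simp only [submatrix_smul, Pi.smul_apply, submatrix_one_equiv] at h
    rw [hF']
    exact h
  have hF'ge : -(K • (1 : Matrix _ _ ℝ)) ≤ F' := by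
    have h := submatrix_le_submatrix (blockDiagonal_le_blockDiagonal hFx_ge) e
    rw [blockDiagonal_const_smul_one] at h
    simp only [submatrix_smul, Pi.smul_apply, submatrix_one_equiv] at h
    rw [hF', ← neg_smul]
    exact h
  -- Theorem 3.4 with `ε/6`
  obtain ⟨k', p, hk', hpdeg, hne, happ⟩ :=
    H34 _ F' Q' hF'symm hQ'dens K hF'ge hF'le (ε / 6) (by positivity)
  -- the entropy deficit: `Q ⪯ ((η + r₀²) r₀/τ)·𝕀`, so `1 + S(Q‖𝕀) ≤ 5 d log n`
  obtain ⟨c, hc⟩ : ∃ c : ℝ, c = 1 * (η + (r₀ : ℝ) ^ 2) * r₀ / t := ⟨_, rfl⟩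
  have hc0 : 0 < c := by rw [hc]; positivity
  have hQ'le : Q' ≤ c • uniformDensity (Fintype.card (Fin k × (Fin n → Bool))) := by
    have hblk : ∀ x, Qx x ≤ (c * (1 / (k * 2 ^ n))) • (1 : Matrix (Fin k) (Fin k) ℝ) := by
      intro x
      rw [hQx' x]
      have h := Thm33.smul_mono (hQle x) (c := 1 / (t * 2 ^ n)) (by positivity)
      rw [uniformDensity, smul_smul, smul_smul] at h
      rw [hc, show 1 * (η + (r₀ : ℝ) ^ 2) * r₀ / t * (1 / (k * 2 ^ n)) =
        1 / (t * 2 ^ n) * (1 * (η + (r₀ : ℝ) ^ 2) * r₀) * (1 / (k : ℝ)) by ring]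
      exact h
    have h := submatrix_le_submatrix (blockDiagonal_le_blockDiagonal hblk) e
    rw [blockDiagonal_const_smul_one] at h
    simp only [submatrix_smul, Pi.smul_apply, submatrix_one_equiv] at h
    rw [hQ', uniformDensity, hRk, smul_smul]
    exact h
  have hS : relEntropy Q' (uniformDensity _) ≤ Real.log c :=
    relEntropy_uniformDensity_le_log hQ'dens hc0 hQ'le
  have hr₀bnd' : (r₀ : ℝ) ≤ bnd := by
    have h1 : (r₀ : ℝ) ≤ (r₀ : ℝ) ^ 2 := le_self_pow₀ hr₀1' two_ne_zero
    have h2 : bnd * entryAverage N ≤ bnd := mul_le_of_le_one_right hbnd0 havg1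
    linarith only [h1, h2, hr₀bnd]
  have hr₀bnd'' : (r₀ : ℝ) ^ 2 / entryAverage N ≤ bnd := (div_le_iff₀ havg).2 hr₀bnd
  have hcle : c ≤ 2 * bnd ^ 2 := by
    have h1 : c ≤ (1 + (r₀ : ℝ) ^ 2) * r₀ / entryAverage N := by
      rw [hc, one_mul]
      calc (η + (r₀ : ℝ) ^ 2) * r₀ / t ≤ (1 + (r₀ : ℝ) ^ 2) * r₀ / t := by
            gcongr
        _ ≤ (1 + (r₀ : ℝ) ^ 2) * r₀ / entryAverage N :=
            div_le_div_of_nonneg_left (by positivity) havg ht_ge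
    have h2 : (1 + (r₀ : ℝ) ^ 2) * r₀ / entryAverage N ≤
        2 * (r₀ : ℝ) * ((r₀ : ℝ) ^ 2 / entryAverage N) := by
      rw [mul_div_assoc']
      refine div_le_div_of_nonneg_right ?_ havg.le
      have h' : (1 : ℝ) ≤ (r₀ : ℝ) ^ 2 := one_le_pow₀ hr₀1'
      nlinarith only [h', hr₀1']
    have h3 : 2 * (r₀ : ℝ) * ((r₀ : ℝ) ^ 2 / entryAverage N) ≤ 2 * bnd * bnd := by
      have := mul_le_mul hr₀bnd' hr₀bnd'' (by positivity) hbnd0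
      linarith only [this]
    have h4 : 2 * bnd * bnd = 2 * bnd ^ 2 := by ring
    linarith only [h1, h2, h3, h4]
  have hlogc : Real.log c ≤ Real.log 2 + 2 * (d * Real.log n) := by
    calc Real.log c ≤ Real.log (2 * bnd ^ 2) := Real.log_le_log hc0 hcle
      _ = Real.log 2 + 2 * Real.log bnd := by
          rw [Real.log_mul (by norm_num) (by positivity), Real.log_pow]; push_cast; ring
      _ ≤ Real.log 2 + 2 * (d * Real.log n) := by
          have : Real.log bnd ≤ Real.log ((n : ℝ) ^ d) := Real.log_le_log hbndpos hbndn
          rw [Real.log_pow] at this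
          linarith
  have h1S : 1 + relEntropy Q' (uniformDensity _) ≤ 5 * (d * Real.log n) := by
    have : Real.log 2 ≤ d * Real.log n := by
      calc Real.log 2 ≤ Real.log n := hlogn
        _ = 1 * Real.log n := (one_mul _).symm
        _ ≤ d * Real.log n := mul_le_mul_of_nonneg_right hd1 hlogn0.le
    linarith only [hS, hlogc, this, hlog2]
  have hk'le : (k' : ℝ) ≤ 30 * C₄ * d * K * Real.log n / ε := by
    refine hk'.trans ?_
    have h1 : C₄ * (1 + relEntropy Q' (uniformDensity _)) * K ≤ C₄ * (5 * (d * Real.log n)) * K :=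
      mul_le_mul_of_nonneg_right (mul_le_mul_of_nonneg_left h1S hC₄.le) hK0.le
    have h2 := div_le_div_of_nonneg_right h1 (by positivity : (0 : ℝ) ≤ ε / 6)
    refine h2.trans (le_of_eq ?_)
    field_simp
    ring
  -- `A_S = P_S^{1/2}`, `B_x = p(F_x)`; degrees
  obtain ⟨A, hA⟩ : ∃ A : {S : Finset (Fin n) // S.card = m} → Matrix (Fin k) (Fin k) ℝ,
      A = fun S => CFC.sqrt (P S) := ⟨_, rfl⟩
  have hP0 : ∀ S, (0 : Matrix (Fin k) (Fin k) ℝ) ≤ P S := fun S =>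
    Matrix.nonneg_iff_posSemidef.2 (hP S)
  have hAA : ∀ S, A S * A S = P S := fun S => by
    rw [hA]
    exact CFC.sqrt_mul_sqrt_self (P S) (hP0 S)
  have hAsymm : ∀ S, (A S).IsSymm := fun S => by
    have h1 : (0 : Matrix (Fin k) (Fin k) ℝ) ≤ A S := by rw [hA]; exact CFC.sqrt_nonneg _
    have h2 : (A S).PosSemidef := Matrix.nonneg_iff_posSemidef.1 h1
    have h3 := h2.1.eq
    rwa [conjTranspose_eq_transpose_of_trivial] at h3
  obtain ⟨B, hB⟩ : ∃ B : (Fin n → Bool) → Matrix (Fin k) (Fin k) ℝ,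
      B = fun x => aeval (Fx x) p := ⟨_, rfl⟩
  have hB' : ∀ x, B x = aeval (Fx x) p := fun x => by rw [hB]
  have hBsymm : ∀ x, (B x).IsSymm := by
    intro x
    rw [hB' x]
    show (aeval (Fx x) p)ᵀ = _
    rw [aeval_eq_sum_range, Matrix.transpose_sum]
    refine sum_congr rfl fun j _ => ?_
    rw [transpose_smul, Matrix.transpose_pow, (hFxsymm x).eq]
  have hFxdeg : ∀ i j, HasDegreeLE m (fun x => Fx x i j) := by
    intro i j
    have h : (fun x => Fx x i j) = fun x => (1 / cS) * ∑ S, P S i j * D (cubeRestrict S x) := by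
      funext x
      rw [hFx' x, Matrix.smul_apply, Matrix.sum_apply, smul_eq_mul]
      congr 1
      exact sum_congr rfl fun S _ => by rw [Matrix.smul_apply, smul_eq_mul, mul_comm]
    rw [h]
    exact (HasDegreeLE.sum univ fun S _ => (hasDegreeLE_comp_cubeRestrict S D).const_mul _).const_mul _
  have hBdeg : ∀ i j, HasDegreeLE (p.natDegree * m) (fun x => B x i j) := by
    intro i j
    rw [hB]
    exact hasDegreeLE_aeval_apply Fx hFxdeg p i j
  -- Theorem 3.5 (degree reduction, proved) for `A, B, τ' = 2r₀²/η`
  have h35 := LeeRaghavendraSteurer2015_thm35_of_nonneg n m d (p.natDegree * m) k hmn A B hAsymm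
    hBdeg D K hD hDK (2 * (r₀ : ℝ) ^ 2 / η) (by positivity) (fun S => by rw [hAA S]; exact hPle S)
  -- `‖A_S B_x‖_F² = Tr(P_S B_x²)`; `E_{S,x}‖A B‖² = E_x‖B‖²`
  have hfrob : ∀ S x, frobSq (A S * B x) = (B x * P S * B x).trace := by
    intro S x
    rw [frobSq_eq_trace, transpose_mul, (hAsymm S).eq, (hBsymm x).eq, Matrix.mul_assoc,
      ← Matrix.mul_assoc (A S) (A S) (B x), hAA S, ← Matrix.mul_assoc]
  have hsumS : ∀ x, ∑ S, frobSq (A S * B x) = cS * frobSq (B x) := by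
    intro x
    simp only [hfrob]
    rw [← trace_sum, ← Finset.sum_mul, ← Finset.mul_sum, hsumP, Matrix.mul_smul, Matrix.mul_one,
      Matrix.smul_mul, trace_smul, smul_eq_mul, frobSq_eq_trace, (hBsymm x).eq]
  have hEAB : subsetCubeExpect n m (fun S x => frobSq (A S * B x)) =
      cubeExpect (fun x => frobSq (B x)) := by
    unfold subsetCubeExpect cubeExpect
    rw [← hcS_def, Finset.sum_comm]
    simp only [hsumS]
    rw [← mul_sum, mul_div_mul_left _ _ hcS.ne']
  -- `p(F') = diag(p(F_x))` and the three traces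
  have hpF' : aeval F' p = (blockDiagonal B).submatrix e e := by
    have h := Polynomial.aeval_algHom_apply (reindexAlgEquiv ℝ ℝ e.symm) (blockDiagonal Fx) p
    simp only [coe_reindexAlgEquiv, reindex_apply, Equiv.symm_symm] at h
    rw [hF', h, aeval_blockDiagonal, hB]
  have htrBB : ∀ x, (B x * B x).trace = frobSq (B x) := fun x => by
    rw [frobSq_eq_trace, (hBsymm x).eq]
  have htr1 : (aeval F' p * aeval F' p).trace = 2 ^ n * cubeExpect (fun x => frobSq (B x)) := by
    rw [hpF', submatrix_mul_equiv, trace_submatrix_equiv, ← blockDiagonal_mul, trace_blockDiagonal]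
    simp only [htrBB]
    unfold cubeExpect
    field_simp
  have htr2 : (F' * (aeval F' p * aeval F' p)).trace =
      2 ^ n * subsetCubeExpect n m (fun S x => D (cubeRestrict S x) * frobSq (A S * B x)) := by
    rw [hpF', hF', submatrix_mul_equiv, submatrix_mul_equiv, trace_submatrix_equiv,
      ← blockDiagonal_mul, ← blockDiagonal_mul, trace_blockDiagonal]
    have hx : ∀ x, (Fx x * (B x * B x)).trace =
        1 / cS * ∑ S, D (cubeRestrict S x) * frobSq (A S * B x) := by
      intro x
      rw [hFx' x, Matrix.smul_mul, trace_smul, smul_eq_mul, Finset.sum_mul, trace_sum]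
      congr 1
      refine sum_congr rfl fun S _ => ?_
      rw [Matrix.smul_mul, trace_smul, smul_eq_mul, hfrob, ← Matrix.mul_assoc,
        Matrix.trace_mul_cycle]
    simp only [hx]
    unfold subsetCubeExpect
    rw [← mul_sum, ← hcS_def, Finset.sum_comm]
    field_simp
  have htr3 : (F' * Q').trace = 1 / t * sepFunctional D T := by
    rw [hF', hQ', submatrix_mul_equiv, trace_submatrix_equiv, ← blockDiagonal_mul,
      trace_blockDiagonal]
    have hx : ∀ x, (Fx x * Qx x).trace =
        1 / (t * 2 ^ n) * (1 / cS * ∑ S, D (cubeRestrict S x) * (P S * Q x).trace) := by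
      intro x
      rw [hQx' x, Matrix.mul_smul, trace_smul, smul_eq_mul, hFx' x, Matrix.smul_mul, trace_smul,
        smul_eq_mul, Finset.sum_mul, trace_sum]
      congr 2
      refine sum_congr rfl fun S _ => ?_
      rw [Matrix.smul_mul, trace_smul, smul_eq_mul]
    simp only [hx]
    unfold sepFunctional subsetCubeExpect
    rw [← mul_sum, ← mul_sum, ← hcS_def, Finset.sum_comm]
    simp only [hT']
    field_simp
  -- `E_x ‖B_x‖_F² > 0` and the ratio
  have hEB0 : 0 ≤ cubeExpect (fun x => frobSq (B x)) := cubeExpect_nonneg fun x => frobSq_nonneg _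
  have hEBpos : 0 < cubeExpect (fun x => frobSq (B x)) := by
    rcases hEB0.eq_or_lt with h | h
    · exfalso
      apply hne
      rw [htr1, ← h, mul_zero]
    · exact h
  obtain ⟨M₀, hM₀⟩ : ∃ M₀ : ℝ, M₀ = 2 * K *
      ((((p.natDegree * m : ℕ) : ℝ) * m) / ((n : ℝ) - m)) ^ ((d : ℝ) / 4) *
      Real.sqrt (2 * (r₀ : ℝ) ^ 2 / η) := ⟨_, rfl⟩
  have hM₀0 : 0 ≤ M₀ := by
    rw [hM₀]
    have : (0 : ℝ) ≤ (((p.natDegree * m : ℕ) : ℝ) * m) / ((n : ℝ) - m) := by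
      apply div_nonneg (by positivity); linarith only [hnm2, hn0]
    exact mul_nonneg (mul_nonneg (by positivity) (Real.rpow_nonneg this _)) (Real.sqrt_nonneg _)
  have hlow : -M₀ ≤ subsetCubeExpect n m (fun S x => D (cubeRestrict S x) * frobSq (A S * B x)) /
      cubeExpect (fun x => frobSq (B x)) := by
    rw [le_div_iff₀ hEBpos]
    rw [hEAB] at h35
    have hsq : Real.sqrt (cubeExpect fun x => frobSq (B x)) *
        Real.sqrt (cubeExpect fun x => frobSq (B x)) = cubeExpect fun x => frobSq (B x) :=
      Real.mul_self_sqrt hEB0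
    rw [hM₀]
    calc -(2 * K * ((((p.natDegree * m : ℕ) : ℝ) * m) / ((n : ℝ) - m)) ^ ((d : ℝ) / 4) *
          Real.sqrt (2 * (r₀ : ℝ) ^ 2 / η)) * cubeExpect (fun x => frobSq (B x))
        = -(2 * K * ((((p.natDegree * m : ℕ) : ℝ) * m) / ((n : ℝ) - m)) ^ ((d : ℝ) / 4) *
          Real.sqrt (2 * (r₀ : ℝ) ^ 2 / η) *
          Real.sqrt (cubeExpect fun x => frobSq (B x)) *
          Real.sqrt (cubeExpect fun x => frobSq (B x))) := by
          conv_lhs => rw [← hsq]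
          ring
      _ ≤ _ := h35
  have hratio : subsetCubeExpect n m (fun S x => D (cubeRestrict S x) * frobSq (A S * B x)) /
      cubeExpect (fun x => frobSq (B x)) ≤ 1 / t * sepFunctional D T + ε / 6 := by
    have h := happ
    rw [htr2, htr1, htr3, mul_div_mul_left _ _ (by positivity : (2 : ℝ) ^ n ≠ 0)] at h
    exact h
  -- `L_D(T) ≥ −τ M₀ − τ ε/6`
  have hLT : -(t * M₀) - t * (ε / 6) ≤ sepFunctional D T := by
    have h : -M₀ - ε / 6 ≤ 1 / t * sepFunctional D T := by linarith only [hlow, hratio]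
    have h1 := mul_le_mul_of_nonneg_left h ht0.le
    rw [← mul_assoc, mul_one_div_cancel ht0.ne', one_mul] at h1
    linarith only [h1]
  -- eq. (sos-2): `L_D(N) ≥ L_D(T) − ‖D‖_∞ η`
  have hA' : sepFunctional D T - K * η ≤ sepFunctional D N := sepFunctional_ge_of_sandwich hDK hPQ' hmn.le
  -- the main estimate `M₀ ≤ ε/6`
  have hρ0 : (0 : ℝ) ≤ (((p.natDegree * m : ℕ) : ℝ) * m) / ((n : ℝ) - m) := by
    apply div_nonneg (by positivity); linarith only [hnm2, hn0]
  have hρle : (((p.natDegree * m : ℕ) : ℝ) * m) / ((n : ℝ) - m) ≤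
      60 * C₄ * d * K * (m : ℝ) ^ 2 * Real.log n / (ε * n) := by
    have hdeg : ((p.natDegree : ℕ) : ℝ) ≤ 30 * C₄ * d * K * Real.log n / ε :=
      le_trans (by exact_mod_cast hpdeg) hk'le
    have hkm0 : 0 ≤ 30 * C₄ * d * K * Real.log n / ε := by positivity
    calc (((p.natDegree * m : ℕ) : ℝ) * m) / ((n : ℝ) - m)
        ≤ (30 * C₄ * d * K * Real.log n / ε * m * m) / ((n : ℝ) - m) := by
          push_cast
          refine div_le_div_of_nonneg_right ?_ (by linarith only [hnm2, hn0])
          exact mul_le_mul_of_nonneg_right (mul_le_mul_of_nonneg_right hdeg (by positivity))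
            (by positivity)
      _ ≤ (30 * C₄ * d * K * Real.log n / ε * m * m) / ((n : ℝ) / 2) :=
          div_le_div_of_nonneg_left (by positivity) (by positivity) hnm2
      _ = 60 * C₄ * d * K * (m : ℝ) ^ 2 * Real.log n / (ε * n) := by
          field_simp
          ring
  have hkey : ((((p.natDegree * m : ℕ) : ℝ) * m) / ((n : ℝ) - m)) ^ ((d : ℝ) / 2) * (r₀ : ℝ) ^ 2 ≤
      1 / 864 * (ε / K) ^ 3 := by
    have h1 : ((((p.natDegree * m : ℕ) : ℝ) * m) / ((n : ℝ) - m)) ^ ((d : ℝ) / 2) ≤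
        (60 * C₄ * d * K * (m : ℝ) ^ 2 * Real.log n / (ε * n)) ^ ((d : ℝ) / 2) :=
      Real.rpow_le_rpow hρ0 hρle (by positivity)
    have h2 : (r₀ : ℝ) ^ 2 ≤ bnd := hr₀bnd.trans (mul_le_of_le_one_right hbnd0 havg1)
    have h3 : (60 * C₄ * d * K * (m : ℝ) ^ 2 * Real.log n / (ε * n)) ^ ((d : ℝ) / 2) * bnd =
        (60 * C₄ * C) ^ ((d : ℝ) / 2) * (ε / K) ^ 3 := by
      rw [hbnd]
      have hx0 : (0 : ℝ) ≤ 60 * C₄ * d * K * (m : ℝ) ^ 2 * Real.log n / (ε * n) := by positivity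
      have hc0' : (0 : ℝ) ≤ (n : ℝ) / Real.log n := by positivity
      calc (60 * C₄ * d * K * (m : ℝ) ^ 2 * Real.log n / (ε * n)) ^ ((d : ℝ) / 2) *
            ((C * ε / (d * (m : ℝ) ^ 2 * K)) ^ ((d : ℝ) / 2) * (ε / K) ^ 3 *
              ((n : ℝ) / Real.log n) ^ ((d : ℝ) / 2))
          = ((60 * C₄ * d * K * (m : ℝ) ^ 2 * Real.log n / (ε * n)) *
              (C * ε / (d * (m : ℝ) ^ 2 * K)) * ((n : ℝ) / Real.log n)) ^ ((d : ℝ) / 2) *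
              (ε / K) ^ 3 := by
            rw [Real.mul_rpow (mul_nonneg hx0 ha₁0) hc0', Real.mul_rpow hx0 ha₁0]; ring
        _ = (60 * C₄ * C) ^ ((d : ℝ) / 2) * (ε / K) ^ 3 := by
            congr 2
            field_simp
    have h4 : (60 * C₄ * C) ^ ((d : ℝ) / 2) ≤ 1 / 864 := by
      have hq0 : (0 : ℝ) < 60 * C₄ * C := by positivity
      calc (60 * C₄ * C) ^ ((d : ℝ) / 2) ≤ (1 / 746496 : ℝ) ^ ((d : ℝ) / 2) :=
            Real.rpow_le_rpow hq0.le h60C (by positivity)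
        _ ≤ (1 / 746496 : ℝ) ^ ((1 : ℝ) / 2) :=
            Real.rpow_le_rpow_of_exponent_ge (by norm_num) (by norm_num) (by linarith only [hd1])
        _ = 1 / 864 := by
            rw [show (1 / 746496 : ℝ) = (1 / 864) ^ 2 by norm_num, ← Real.sqrt_eq_rpow,
              Real.sqrt_sq (by norm_num)]
    calc _ ≤ (60 * C₄ * d * K * (m : ℝ) ^ 2 * Real.log n / (ε * n)) ^ ((d : ℝ) / 2) * bnd :=
          mul_le_mul h1 h2 (by positivity) (by positivity)
      _ = (60 * C₄ * C) ^ ((d : ℝ) / 2) * (ε / K) ^ 3 := h3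
      _ ≤ 1 / 864 * (ε / K) ^ 3 := mul_le_mul_of_nonneg_right h4 (by positivity)
  have hM₀le : M₀ ≤ ε / 6 := by
    have hsq : M₀ ^ 2 = 24 * K ^ 3 / ε *
        (((((p.natDegree * m : ℕ) : ℝ) * m) / ((n : ℝ) - m)) ^ ((d : ℝ) / 2) * (r₀ : ℝ) ^ 2) := by
      rw [hM₀]
      have h1 : (((((p.natDegree * m : ℕ) : ℝ) * m) / ((n : ℝ) - m)) ^ ((d : ℝ) / 4)) ^ 2 =
          ((((p.natDegree * m : ℕ) : ℝ) * m) / ((n : ℝ) - m)) ^ ((d : ℝ) / 2) := by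
        rw [← Real.rpow_natCast, ← Real.rpow_mul hρ0]
        norm_num
        ring_nf
      have h2 : Real.sqrt (2 * (r₀ : ℝ) ^ 2 / η) ^ 2 = 2 * (r₀ : ℝ) ^ 2 / η :=
        Real.sq_sqrt (by positivity)
      rw [mul_pow, mul_pow, mul_pow, h1, h2, hη]
      field_simp
      ring
    have hsq' : M₀ ^ 2 ≤ (ε / 6) ^ 2 := by
      rw [hsq]
      have := mul_le_mul_of_nonneg_left hkey (by positivity : (0 : ℝ) ≤ 24 * K ^ 3 / ε)
      refine this.trans (le_of_eq ?_)
      field_simp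
      ring
    have := abs_le_of_sq_le_sq hsq' (by positivity)
    rw [abs_of_nonneg hM₀0] at this
    exact this
  -- conclusion
  have htM : t * M₀ ≤ 2 * (ε / 6) := by
    have := mul_le_mul ht2 hM₀le hM₀0 (by norm_num)
    linarith only [this]
  have htε : t * (ε / 6) ≤ 2 * (ε / 6) := mul_le_mul_of_nonneg_right ht2 (by positivity)
  rw [hKη] at hA'
  linarith only [hA', hLT, htM, htε]

/-- **Lee–Raghavendra–Steurer 2015, Theorem 3.1 from John's-position rescaling and Thm 3.4:**
with Thm 3.3 derived from [FawziEtAl2015, Cor. 6.8] (`LeeRaghavendraSteurer2015_thm33_of_cor68`)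
the separation theorem `LeeRaghavendraSteurer2015_thm31` follows from the two remaining named facts
`FawziEtAl2015_cor68` and `LeeRaghavendraSteurer2015_thm34`. [cite: LeeRaghavendraSteurer2015, Thm. 3.1 (p. 14), proof p. 14–16] -/
theorem LeeRaghavendraSteurer2015_thm31_of_cor68_thm34
    (h68 : FawziEtAl2015_cor68) (h34 : LeeRaghavendraSteurer2015_thm34) :
    LeeRaghavendraSteurer2015_thm31 :=
  LeeRaghavendraSteurer2015_thm31_of_thm33_thm34 (LeeRaghavendraSteurer2015_thm33_of_cor68 h68) h34

end Literature.Combinatorics.Optimization
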